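import Literature.NumberTheory.GaloisRepresentations.IdeleTruncationLimit
import Literature.NumberTheory.GaloisRepresentations.GalLayerSystemLayers
import HarnessLib

/-!
# `J_{K_S} := J̄^{N_S}` as a `G_S`-module and the truncation `J_{K_S} ↠ I_S` as a morphism of `Rep ℤ G_S`
# (Harari, *Galois Cohomology and CFT*, §17.4 (17.1); Milne ADT I §4)

Topic `NumberTheory/GaloisRepresentations`; namespace `Literature.NumberTheory.GaloisRepresentations.IdeleClassBar`; the
idèle twin of -w3 g17's `IdeleClassBarKS.lean` (`classBarKS K S = C̄^{N_S}`), a sequel to `IdeleTruncationLimit.lean`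
(`truncBar`, `I_S = truncBar (J̄^{N_S})`).  Definitions with bodies and theorems; NO named fact, no `sorry`, no instance,
no notation; number fields in `Type`.

## What is formalised (`K : Type` a number field, `S : Finset (HeightOneSpectrum (𝓞 K))`, `G_S = Γ_K ⧸ N_S`)

* **`ideleBarKS K S : Rep ℤ G_S := (invariantsQuotFunctor ℤ N_S).obj J̄`** (`J_{K_S} = J̄^{N_S} = ⋃_{E ⊆ K_S} J_E`),
  `mem_ideleInvariantsKS_iff_forall`, **`mem_ideleInvariantsKS_iff`** (fixed by `N_S` iff from a layer inside `K_S`),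
  `coe_ideleBarKS_ρ_mk` (`rfl`).
* **`truncKSAddHom`, `truncKS K S : ideleBarKS K S ⟶ truncIdeleBarRep K S`** (the truncation `J_{K_S} → I_S` as a
  morphism of `G_S`-representations), `coe_truncKSAddHom_apply` / `truncKS_hom_apply` (`rfl`), **`truncKSAddHom_surjective`**,
  **`truncKS_surjective`**, `coe_truncKSAddHom_apply_eq_self` (on the image of `I_S ≤ J̄^{N_S}` it is the identity).

Written for lane «PT-Ш-S-TC» (brick D3) of crux `GoodLatticeBDPValue` (cell bsd-eis, item 19032), seat bsd-line-x1-p1-w6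
gen 10.  HONEST FRAMING: bookkeeping; no arithmetic statement and no case of BSD is proved here.

## References
* D. Harari, *Galois Cohomology and Class Field Theory*, Universitext, Springer (2020), §17.4 (17.1). [Harari2020]
* J. S. Milne, *Arithmetic Duality Theorems*, 2nd ed. (2006), I §4 (p. 55). [MilneADT2006]
-/

noncomputable section

open NumberField IsDedekindDomain CategoryTheory
open Field (absoluteGaloisGroup)
open Literature.NumberTheory.Automorphic Literature.Algebra.Homology
open scoped Classical

namespace Literature.NumberTheory.GaloisRepresentations

namespace IdeleClassBar

variable (K : Type) [Field K] [NumberField K] (S : Finset (HeightOneSpectrum (𝓞 K)))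

/-- **`J_{K_S} := J̄^{N_S}` as a representation of `G_S = Γ_K ⧸ N_S`** (door-c4's invariants-quotient functor at the
closed normal subgroup `N_S`; the idèle twin of `classBarKS`). [cite: Harari2020, §17.4 (17.1)] [cite: MilneADT2006, I §4] -/
abbrev ideleBarKS : Rep ℤ (GaloisGroupUnramifiedOutside K (↑S : Set (HeightOneSpectrum (𝓞 K)))) :=
  (DiscreteRep.invariantsQuotFunctor ℤ (ramificationSubgroup K (↑S : Set (HeightOneSpectrum (𝓞 K))))).obj
    (ideleData K).toSystem.toD

variable {K}

/-- Membership in `J̄^{N_S}`: fixed by `N_S`. [cite: Harari2020, §17.4 (17.1)] -/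
theorem mem_ideleInvariantsKS_iff_forall (z : (ideleData K).toSystem.limit) :
    z ∈ Representation.invariants ((ideleData K).toSystem.toRep.ρ.comp
        (ramificationSubgroup K (↑S : Set (HeightOneSpectrum (𝓞 K)))).subtype) ↔
      ∀ σ ∈ ramificationSubgroup K (↑S : Set (HeightOneSpectrum (𝓞 K))), (ideleData K).toSystem.rep σ z = z := by
  rw [Representation.mem_invariants]
  exact ⟨fun h σ hσ => h ⟨σ, hσ⟩, fun h g => h g.1 g.2⟩

/-- **`J̄^{N_S} = ⋃_{E ⊆ K_S} J_E`**: an element of `J̄` is fixed by `N_S` iff it comes from a layer inside `K_S`.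
[cite: Harari2020, §17.4 (17.1)] [cite: MilneADT2006, I §4 (p. 55)] -/
theorem mem_ideleInvariantsKS_iff (z : (ideleData K).toSystem.limit) :
    z ∈ Representation.invariants ((ideleData K).toSystem.toRep.ρ.comp
        (ramificationSubgroup K (↑S : Set (HeightOneSpectrum (𝓞 K)))).subtype) ↔
      ∃ (E : GalLayer K) (_ : ramificationSubgroup K (↑S : Set (HeightOneSpectrum (𝓞 K))) ≤
          (E.openNormalSubgroup : Subgroup (absoluteGaloisGroup K)))
        (x : (ideleData K).V E), (ideleData K).toSystem.of E x = z := by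
  rw [mem_ideleInvariantsKS_iff_forall]
  constructor
  · exact exists_layer_insideKS_of_forall_rep_eq z
  · rintro ⟨E, hE, x, rfl⟩ σ hσ
    exact (ideleData K).toSystem.rep_of_of_mem E (hE hσ) x

variable (K)

/-- The underlying vector of `[σ] • z` in `J_{K_S}` is `σ • z` (definitional). [cite: Harari2020, §17.4 (17.1)] -/
theorem coe_ideleBarKS_ρ_mk (σ : absoluteGaloisGroup K) (z : (ideleBarKS K S).V) :
    (((ideleBarKS K S).ρ (QuotientGroup.mk σ) z).1 : (ideleData K).toSystem.limit) =
      (ideleData K).toSystem.rep σ (z.1 : (ideleData K).toSystem.limit) := rfl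

/-- **The truncation `J_{K_S} → I_S` on underlying groups** (`truncBar` lands in `I_S` on `N_S`-invariants,
`truncBar_mem_truncIdeleBar`). [cite: Harari2020, §17.4 (17.1)] -/
def truncKSAddHom : (ideleBarKS K S).V →+ truncIdeleBar K S where
  toFun z := ⟨truncBar K S (z.1 : (ideleData K).toSystem.limit),
    truncBar_mem_truncIdeleBar ((mem_ideleInvariantsKS_iff_forall S _).1 z.2)⟩
  map_zero' := Subtype.ext (map_zero (truncBar K S))
  map_add' z z' := Subtype.ext (map_add (truncBar K S) z.1 z'.1)

/-- Formula. [cite: Harari2020, §17.4 (17.1)] -/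
@[simp] theorem coe_truncKSAddHom_apply (z : (ideleBarKS K S).V) :
    ((truncKSAddHom K S z : truncIdeleBar K S) : (ideleData K).toSystem.limit) =
      truncBar K S (z.1 : (ideleData K).toSystem.limit) := rfl

/-- **The truncation `J_{K_S} ↠ I_S` as a morphism of `Rep ℤ G_S`** (equivariant by `truncBar_rep`).
[cite: Harari2020, §17.4 (17.1)] -/
def truncKS : ideleBarKS K S ⟶ truncIdeleBarRep K S :=
  letI : Module ℤ (ideleBarKS K S).V := (ideleBarKS K S).hV2
  Rep.ofHom
    ⟨{ toFun := truncKSAddHom K S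
       map_add' := fun z z' => map_add _ z z'
       map_smul' := fun c z => by
         have h := map_intCast_smul (truncKSAddHom K S) ℤ ℤ c z
         rw [RingHom.id_apply]
         exact h },
      fun g => LinearMap.ext fun z => by
        obtain ⟨σ, rfl⟩ := QuotientGroup.mk_surjective g
        apply Subtype.ext
        change truncBar K S ((ideleData K).toSystem.rep σ (z.1 : (ideleData K).toSystem.limit)) =
          (ideleData K).toSystem.rep σ (truncBar K S (z.1 : (ideleData K).toSystem.limit))
        exact truncBar_rep K S σ _⟩

/-- **`J_{K_S} ↠ I_S` is surjective** on underlying groups (an element of `I_S` is `N_S`-invariant and its own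
truncation). [cite: Harari2020, §17.4 (17.1)] -/
theorem truncKSAddHom_surjective : Function.Surjective (truncKSAddHom K S) := fun z =>
  ⟨⟨(z.1 : (ideleData K).toSystem.limit), (mem_ideleInvariantsKS_iff_forall S _).2
      fun _ hσ => rep_eq_self_of_mem_ramificationSubgroup hσ z.2⟩,
    Subtype.ext (truncBar_eq_self_of_mem z.2)⟩

/-- The truncation is the identity on (the image of) `I_S` in `J_{K_S}`. [cite: Harari2020, §17.4 (17.1)] -/
theorem coe_truncKSAddHom_apply_eq_self (z : (ideleBarKS K S).V)
    (hz : (z.1 : (ideleData K).toSystem.limit) ∈ truncIdeleBar K S) :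
    ((truncKSAddHom K S z : truncIdeleBar K S) : (ideleData K).toSystem.limit) = z.1 :=
  truncBar_eq_self_of_mem hz

/-- Formula: the morphism `truncKS` is `truncKSAddHom` on vectors (definitional). [cite: Harari2020, §17.4 (17.1)] -/
theorem truncKS_hom_apply (z : (ideleBarKS K S).V) :
    (truncKS K S).hom z = (show (ideleBarKS K S).V → (truncIdeleBarRep K S).V from truncKSAddHom K S) z := rfl

/-- **`truncKS : J_{K_S} ⟶ I_S` is an epimorphism** (surjective on vectors). [cite: Harari2020, §17.4 (17.1)] -/
theorem truncKS_surjective : Function.Surjective (truncKS K S).hom := fun y => by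
  obtain ⟨z, hz⟩ := truncKSAddHom_surjective K S y
  exact ⟨z, hz⟩

end IdeleClassBar

end Literature.NumberTheory.GaloisRepresentations

end
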